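import Summits.QuantumFields.YangMills.Theorems.FlatTubeReductionBORateBricksCore
import HarnessLib

/-!
# The RATE-GRADE tube package WITH A SECOND-MOMENT OFF-DIAGONAL BUDGET («ratepack-v3 / frozen fibres»), its Feshbach endgame, and the chain to K1
# (route `FlatTubeReduction`, crux K1 `NearFlatRatioLaw` stmt-QuantumFields-24720; seat `ym-line-ftr-p1` g12; R2b1 RECORD rung — no summit statement is proved here)

WHY (lead g12, crux workfile `Cruxes/NearFlatRatioLaw/Lines/ratepack-v3-frozen-g12.md`).  The rate package of «ratepack»/«ratepack-v2» (`RateTube.SoftTubeBORatePackageOn`, p648741)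
asks for a UNIFORM off-diagonal size `b² ≤ Cλ_b²θ/16`; with FROZEN (slow-point independent) fibre profiles the Feshbach coupling is first order in the slow amplitude, so only
`b(u)² ≲ λ_b³ + κ_b·orbitDist(u)²` holds — uniformity would need ADAPTED fibres (the XL item of v2).  THIS FILE types the package with the off-diagonal term budgeted by
`√(b²‖u_a‖² + P a)` for a nonnegative family functional `P` (the second-moment potential of the slow coefficient), moves `P` through the completed square into the SLOW clause
(`T(u_a) + (4/θ)σμ₀·P a ≤ e^{Cλ_b²/4}σμ_k‖u_a‖²` — exactly what the dressed one-site no-intruder WITH POTENTIAL `dressedOneOrbitRatePot_of_eigenMoments` delivers from (EM)), and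
re-runs the landed chain:
* `RateTube.SoftTubeBORatePackagePotOn L χ S` — the v3 package (FLOOR, MASS, STIFF, SPLIT′ with `√(b²N(u_a) + P a)`, SLOW′ with `+ (4/θ)σμ₀ P a`);
* ★ `ratePackagePotOn_of_ratePackageOn` — v2's package is the case `P = 0` (so v3 generalises v2);
* ★★★ `softTubeNoIntruderRateOn_of_ratePackagePot` — the Feshbach endgame: AM–GM `2σμ₀√P√N_v ≤ (4/θ)σμ₀P + (θ/4)σμ₀N_v` shrinks the stiff gap to `3θ/4`, then lane A's
  `feshbach_endgame` VERBATIM with `ε := (4C/3)λ_b`; conclusion = `RateTube.SoftTubeNoIntruderRateOn L χ S` (p648741), whence the landed chain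
  `oneOrbitRate_of_softTubeRateOn → innerRate_of_oneOrbitRate` applies unchanged: ★★★ `innerRateAt_of_ratePackagePot`;
* ★★★★ `nearFlatRatioLaw_of_ratePackagePot_shell` — K1 ⟸ (∀ L ≥ 2, the v3 package for the record core weight `recordChi L (1/6) 43 M` on `{orbitDist < β^{-1/6}}`) + lane A's SHELL
  (`nearFlatRatioLaw_of_coreRate_shell_pow`, p660969).
HONEST FRAMING: typed target + endgame algebra over landed doors; the v3 package itself is OPEN fixed-lattice semiclassics on `SU(2)^{3L³}` (frozen-fibre bricks (B-N)(B-T)(B-ST)(B-OD′)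
with honest two-slice Gaussian evaluation); femto rung R2b1 (RECORD label); not infinite volume, not a gap, not Clay.  One new `def` (target text), no named facts, no `sorry`.
-/

set_option autoImplicit false

noncomputable section

open MeasureTheory Filter Topology Real
open scoped BigOperators
open Literature.MathematicalPhysics.QuantumFieldTheory
open Literature.MathematicalPhysics.QuantumLattice

namespace Summit.QuantumFields.YangMills.Theorems.FemtoTransferGap.RateTube

open Summit.QuantumFields.YangMills.Theorems.FemtoTransferGap
open Summit.QuantumFields.YangMills.Theorems.FemtoTransferGap.TwoLattice.Avg
open Summit.QuantumFields.YangMills.Theorems.FemtoTransferGap.TwoLattice.ConstTube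
open Summit.QuantumFields.YangMills.Theorems.FemtoCutoffLadder

variable {L : ℕ} [NeZero L]

/-! ## §1 The v3 package: off-diagonal budget `√(b²N(u_a) + P a)`, slow clause with the potential `(4/θ)σμ₀ P a` -/

variable (L) in
/-- **THE BORN–OPPENHEIMER TUBE PACKAGE WITH RATE AND A SECOND-MOMENT OFF-DIAGONAL BUDGET** (target text of «ratepack-v3»; OPEN): for every level `k` there are `C ≥ 0`, a stiff
gap `θ ∈ (0,1]` and `β₀` such that for `β ≥ β₀` there are `σ > 0`, `b ≥ 0` with `b² ≤ Cλ_b²θ/16`, the FLOOR `e^{−Cλ_b²/4}σμ₀ ≤ λ₀`, and for every admissible family `f` a split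
`f = u + v` AND a nonnegative functional `P` of the coefficients with: MASS, STIFF `T(v_a) ≤ (1−θ)σμ₀‖v_a‖²`, SPLIT′ `T(f_a) ≤ T(u_a) + 2σμ₀√(b²‖u_a‖² + P a)·‖v_a‖ + T(v_a)`, and
SLOW′ `∃ a ≠ 0, T(u_a) + (4/θ)σμ₀·P a ≤ e^{Cλ_b²/4}σμ_k‖u_a‖²`.  (Frozen fibres: `P a = κ_bγ∫_{orbitDist<δ₁} orbitDist²·φ_a²`, `φ_a` the slow coefficient.)
[cite: Luscher1983, §3] [cite: SjostrandZworski2007, §2] [cite: GustafsonSigal2003, §11–§12] -/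
def SoftTubeBORatePackagePotOn (χ : ℝ → GaugeConfig 3 L SU2 → ℝ) (S : ℝ → Set (GaugeConfig 3 L SU2)) : Prop :=
  ∀ k : ℕ, ∃ C θ : ℝ, 0 ≤ C ∧ 0 < θ ∧ θ ≤ 1 ∧ ∃ β0 : ℝ, ∀ β : ℝ, β0 ≤ β →
    ∃ σ b : ℝ, 0 < σ ∧ 0 ≤ b ∧ b ^ 2 ≤ C * bareLambda ((L : ℝ) ^ 3 * β) ^ 2 * θ / 16 ∧
      Real.exp (-(C * bareLambda ((L : ℝ) ^ 3 * β) ^ 2 / 4)) * (σ * levelValue su2Rep 1 ((L : ℝ) ^ 3 * β) 0) ≤ levelValue su2Rep L β 0 ∧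
      ∀ f : Fin (k + 1) → (GaugeConfig 3 L SU2 → ℝ),
        (∀ i, Measurable (f i)) → (∀ i, ∃ C' : ℝ, ∀ U, |f i U| ≤ C') → (∀ i U, f i U ≠ 0 → χ β U ≠ 0) → (∀ i U, f i U ≠ 0 → U ∈ S β) →
        (∀ a : Fin (k + 1) → ℝ, a ≠ 0 → 0 < tubeNormSq (softWeight (χ β)) (fun U => ∑ i, a i * f i U)) →
          ∃ (u v : Fin (k + 1) → (GaugeConfig 3 L SU2 → ℝ)) (P : (Fin (k + 1) → ℝ) → ℝ),
            (∀ a : Fin (k + 1) → ℝ,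
              0 ≤ P a ∧
              0 ≤ tubeNormSq (softWeight (χ β)) (fun U => ∑ i, a i * u i U) ∧
              0 ≤ tubeNormSq (softWeight (χ β)) (fun U => ∑ i, a i * v i U) ∧
              tubeNormSq (softWeight (χ β)) (fun U => ∑ i, a i * u i U) + tubeNormSq (softWeight (χ β)) (fun U => ∑ i, a i * v i U) ≤
                tubeNormSq (softWeight (χ β)) (fun U => ∑ i, a i * f i U) ∧
              tubeForm β (fun U => ∑ i, a i * v i U) ≤
                (1 - θ) * (σ * levelValue su2Rep 1 ((L : ℝ) ^ 3 * β) 0) * tubeNormSq (softWeight (χ β)) (fun U => ∑ i, a i * v i U) ∧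
              tubeForm β (fun U => ∑ i, a i * f i U) ≤
                tubeForm β (fun U => ∑ i, a i * u i U) +
                  2 * (σ * levelValue su2Rep 1 ((L : ℝ) ^ 3 * β) 0) *
                    Real.sqrt (b ^ 2 * tubeNormSq (softWeight (χ β)) (fun U => ∑ i, a i * u i U) + P a) *
                    Real.sqrt (tubeNormSq (softWeight (χ β)) (fun U => ∑ i, a i * v i U)) +
                  tubeForm β (fun U => ∑ i, a i * v i U)) ∧
            ∃ a : Fin (k + 1) → ℝ, a ≠ 0 ∧
              tubeForm β (fun U => ∑ i, a i * u i U) + 4 / θ * (σ * levelValue su2Rep 1 ((L : ℝ) ^ 3 * β) 0) * P a ≤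
                Real.exp (C * bareLambda ((L : ℝ) ^ 3 * β) ^ 2 / 4) * (σ * levelValue su2Rep 1 ((L : ℝ) ^ 3 * β) k) *
                  tubeNormSq (softWeight (χ β)) (fun U => ∑ i, a i * u i U)

/-- ★ **v3 generalises v2**: the uniform-`b` package `SoftTubeBORatePackageOn` (p648741) is the case `P = 0` of the v3 package. [folklore] -/
theorem ratePackagePotOn_of_ratePackageOn {χ : ℝ → GaugeConfig 3 L SU2 → ℝ} {S : ℝ → Set (GaugeConfig 3 L SU2)} (hP : SoftTubeBORatePackageOn L χ S) :
    SoftTubeBORatePackagePotOn L χ S := by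
  intro k
  obtain ⟨C, θ, hC0, hθ, hθ1, β0, hβ0⟩ := hP k
  refine ⟨C, θ, hC0, hθ, hθ1, β0, fun β hβ => ?_⟩
  obtain ⟨σ, b, hσ, hb, hb2, hfloor, hsplit⟩ := hβ0 β hβ
  refine ⟨σ, b, hσ, hb, hb2, hfloor, fun f hfm hfb hfs hfS hGram => ?_⟩
  obtain ⟨u, v, hall, a, ha, hslow⟩ := hsplit f hfm hfb hfs hfS hGram
  refine ⟨u, v, fun _ => 0, fun a' => ?_, a, ha, by rw [mul_zero, add_zero]; exact hslow⟩
  obtain ⟨hNu, hNv, hN, hvv, hQ⟩ := hall a'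
  refine ⟨le_rfl, hNu, hNv, hN, hvv, ?_⟩
  have e : Real.sqrt (b ^ 2 * tubeNormSq (softWeight (χ β)) (fun U => ∑ i, a' i * u i U) + 0) = b * Real.sqrt (tubeNormSq (softWeight (χ β)) (fun U => ∑ i, a' i * u i U)) := by
    rw [add_zero, Real.sqrt_mul' _ hNu, Real.sqrt_sq hb]
  rw [e]
  have e2 : 2 * (σ * levelValue su2Rep 1 ((L : ℝ) ^ 3 * β) 0) * (b * Real.sqrt (tubeNormSq (softWeight (χ β)) fun U => ∑ i, a' i * u i U)) *
      Real.sqrt (tubeNormSq (softWeight (χ β)) fun U => ∑ i, a' i * v i U) =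
      2 * (b * (σ * levelValue su2Rep 1 ((L : ℝ) ^ 3 * β) 0)) * Real.sqrt (tubeNormSq (softWeight (χ β)) fun U => ∑ i, a' i * u i U) *
        Real.sqrt (tubeNormSq (softWeight (χ β)) fun U => ∑ i, a' i * v i U) := by ring
  rw [e2]; exact hQ

/-! ## §2 ★★★ The Feshbach endgame with the potential -/

/-- **AM–GM for the potential part of the off-diagonal budget**: for `σμ₀ ≥ 0`, `θ > 0`, `N_u, N_v, P ≥ 0`, `b ≥ 0`:
`2σμ₀√(b²N_u + P)√N_v ≤ 2(bσμ₀)√N_u√N_v + (4/θ)σμ₀P + (θ/4)σμ₀N_v`. [folklore] -/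
theorem offdiag_pot_split {s θ b Nu Nv P : ℝ} (hs : 0 ≤ s) (hθ : 0 < θ) (hb : 0 ≤ b) (hNu : 0 ≤ Nu) (hNv : 0 ≤ Nv) (hP : 0 ≤ P) :
    2 * s * Real.sqrt (b ^ 2 * Nu + P) * Real.sqrt Nv ≤ 2 * (b * s) * Real.sqrt Nu * Real.sqrt Nv + 4 / θ * s * P + θ / 4 * s * Nv := by
  -- `√(b²N_u + P) ≤ b√N_u + √P`
  have h1 : Real.sqrt (b ^ 2 * Nu + P) ≤ b * Real.sqrt Nu + Real.sqrt P := by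
    have hx : 0 ≤ b * Real.sqrt Nu + Real.sqrt P := by positivity
    rw [Real.sqrt_le_left hx]
    have e : (b * Real.sqrt Nu + Real.sqrt P) ^ 2 = b ^ 2 * Nu + P + 2 * (b * Real.sqrt Nu * Real.sqrt P) := by
      rw [add_sq, mul_pow, Real.sq_sqrt hNu, Real.sq_sqrt hP]; ring
    rw [e]
    have : 0 ≤ b * Real.sqrt Nu * Real.sqrt P := by positivity
    linarith
  -- `2√P√N_v ≤ (4/θ)P + (θ/4)N_v`
  have h2 : 2 * Real.sqrt P * Real.sqrt Nv ≤ 4 / θ * P + θ / 4 * Nv := by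
    have h := two_mul_le_div_add_mul (x := Real.sqrt P) (y := Real.sqrt Nv) (s := θ / 4) (by positivity)
    rw [Real.sq_sqrt hP, Real.sq_sqrt hNv] at h
    have e : P / (θ / 4) = 4 / θ * P := by field_simp
    rw [e] at h
    exact h
  have h3 : 2 * s * Real.sqrt (b ^ 2 * Nu + P) * Real.sqrt Nv ≤ 2 * s * (b * Real.sqrt Nu + Real.sqrt P) * Real.sqrt Nv :=
    mul_le_mul_of_nonneg_right (mul_le_mul_of_nonneg_left h1 (by positivity)) (Real.sqrt_nonneg _)
  have h4 : 2 * s * (b * Real.sqrt Nu + Real.sqrt P) * Real.sqrt Nv = 2 * (b * s) * Real.sqrt Nu * Real.sqrt Nv + s * (2 * Real.sqrt P * Real.sqrt Nv) := by ring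
  have h5 : s * (2 * Real.sqrt P * Real.sqrt Nv) ≤ s * (4 / θ * P + θ / 4 * Nv) := mul_le_mul_of_nonneg_left h2 hs
  calc 2 * s * Real.sqrt (b ^ 2 * Nu + P) * Real.sqrt Nv ≤ 2 * (b * s) * Real.sqrt Nu * Real.sqrt Nv + s * (2 * Real.sqrt P * Real.sqrt Nv) := by rw [← h4]; exact h3
    _ ≤ 2 * (b * s) * Real.sqrt Nu * Real.sqrt Nv + s * (4 / θ * P + θ / 4 * Nv) := by linarith
    _ = 2 * (b * s) * Real.sqrt Nu * Real.sqrt Nv + 4 / θ * s * P + θ / 4 * s * Nv := by ring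

set_option maxHeartbeats 400000 in
/-- ★★★ **`SoftTubeBORatePackagePotOn L χ S → SoftTubeNoIntruderRateOn L χ S`**: the potential is moved into the slow block (`offdiag_pot_split`), the stiff gap shrinks to `3θ/4`,
and lane A's `feshbach_endgame` runs VERBATIM with `ε := (4C/3)λ_b` (`b² ≤ Cλ_b²θ/16 = ε(3θ/4)λ_b/16`, `e^{Cλ_b²/4} ≤ e^{ελ_b/4}`, floor `e^{−ελ_b/4} ≤ e^{−Cλ_b²/4}`); the one-site
levels (`μ_k ≥ μ₀/2`, `μ_k ≥ (1 − 3θ/8)μ₀` eventually) from crux ONE.  Conclusion with constant `4C/3`. [cite: Luscher1983, §3] [cite: SjostrandZworski2007, §2] -/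
theorem softTubeNoIntruderRateOn_of_ratePackagePot {χ : ℝ → GaugeConfig 3 L SU2 → ℝ} {S : ℝ → Set (GaugeConfig 3 L SU2)} (hP : SoftTubeBORatePackagePotOn L χ S) :
    SoftTubeNoIntruderRateOn L χ S := by
  intro k
  have hL1 : (1 : ℝ) ≤ (L : ℝ) ^ 3 := one_le_pow₀ (by exact_mod_cast NeZero.one_le)
  obtain ⟨C1, B0, hONE⟩ := oneSiteLevels_proof k
  obtain ⟨C, θ, hC0, hθ, hθ1, βP, hPk⟩ := hP k
  -- the shrunken stiff gap `θ' = 3θ/4` and `ε = (4C/3)λ`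
  set θ' : ℝ := 3 * θ / 4 with hθ'
  have hθ'0 : 0 < θ' := by rw [hθ']; positivity
  have hθ'1 : θ' ≤ 1 := by rw [hθ']; linarith
  set τ : ℝ := θ' / (2 * (|levelGap k| + |C1| + 2)) with hτ
  have hτ0 : 0 < τ := by rw [hτ]; positivity
  refine ⟨4 * C / 3, max (max 1 B0) (max βP (2 / τ ^ 3)), fun β hβ => ?_⟩
  have hβ1 : 1 ≤ β := ((le_max_left _ _).trans (le_max_left _ _)).trans hβ
  have hβ0 : 0 < β := by linarith
  have hβB0 : B0 ≤ β := ((le_max_right _ _).trans (le_max_left _ _)).trans hβ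
  have hβP : βP ≤ β := ((le_max_left _ _).trans (le_max_right _ _)).trans hβ
  have hβτ : 2 / τ ^ 3 ≤ β := ((le_max_right _ _).trans (le_max_right _ _)).trans hβ
  intro f hfm hfb hfs hfS hGram
  have hB'β : β ≤ (L : ℝ) ^ 3 * β := by nlinarith
  have hB'0 : 0 < (L : ℝ) ^ 3 * β := lt_of_lt_of_le hβ0 hB'β
  obtain ⟨hμ0, -, hμk⟩ := hONE ((L : ℝ) ^ 3 * β) (hβB0.trans hB'β)
  set lam := bareLambda ((L : ℝ) ^ 3 * β) with hlamdef
  set μ0 := levelValue su2Rep 1 ((L : ℝ) ^ 3 * β) 0 with hμ0def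
  set μk := levelValue su2Rep 1 ((L : ℝ) ^ 3 * β) k with hμkdef
  have hlam0 : 0 < lam := bareLambda_pos' hB'0
  have hlamτ : lam ≤ τ := bareLambda_cube_le (L := L) hτ0 hβτ
  have hτle : τ ≤ 1 / (2 * (|levelGap k| + |C1| + 2)) := by
    rw [hτ]; exact div_le_div_of_nonneg_right hθ'1 (by positivity)
  obtain ⟨-, -, hy⟩ := smallness_of_le hlam0.le (hlamτ.trans hτle)
  have hμk' : Real.exp (-(levelGap k * lam + |C1| * lam ^ 2)) * μ0 ≤ μk := by
    refine le_trans (mul_le_mul_of_nonneg_right (Real.exp_le_exp.2 ?_) hμ0.le) hμk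
    have := mul_le_mul_of_nonneg_right (le_abs_self C1) (sq_nonneg lam)
    linarith
  have hμk2 := half_le_of_exp_lower hy hμ0.le hμk'
  have hyθ : levelGap k * lam + |C1| * lam ^ 2 ≤ θ' / 2 := by
    have hlam1 : lam ≤ 1 := by
      have : τ ≤ 1 / (2 * 2) := hτle.trans (by
        apply div_le_div_of_nonneg_left (by norm_num) (by norm_num)
        nlinarith [abs_nonneg (levelGap k), abs_nonneg C1])
      linarith
    have h1 : levelGap k * lam ≤ |levelGap k| * lam := mul_le_mul_of_nonneg_right (le_abs_self _) hlam0.le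
    have h2 : |C1| * lam ^ 2 ≤ |C1| * lam := by
      refine mul_le_mul_of_nonneg_left ?_ (abs_nonneg _); nlinarith
    have h3 : (|levelGap k| + |C1|) * lam ≤ (|levelGap k| + |C1|) * τ := mul_le_mul_of_nonneg_left hlamτ (by positivity)
    have h4 : (|levelGap k| + |C1|) * τ ≤ θ' / 2 := by
      rw [hτ]
      have hpos : 0 < 2 * (|levelGap k| + |C1| + 2) := by positivity
      rw [mul_div_assoc', div_le_iff₀ hpos]
      nlinarith [abs_nonneg (levelGap k), abs_nonneg C1]
    linarith
  have hμkθ : (1 - θ' / 2) * μ0 ≤ μk := by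
    refine le_trans (mul_le_mul_of_nonneg_right ?_ hμ0.le) hμk'
    have := Real.add_one_le_exp (-(levelGap k * lam + |C1| * lam ^ 2))
    linarith
  obtain ⟨σ, b, hσ, hb, hb2, hfloor, hsplit⟩ := hPk β hβP
  obtain ⟨u, v, P, hall, a, ha, huu⟩ := hsplit f hfm hfb hfs hfS hGram
  obtain ⟨hPa, hNu, hNv, hN, hvv, hQ⟩ := hall a
  refine ⟨a, ha, ?_⟩
  have hσμ0 : 0 ≤ σ * μ0 := mul_nonneg hσ.le hμ0.le
  -- move the potential into the slow block, the `θ/4` into the stiff block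
  set Nu := tubeNormSq (softWeight (χ β)) (fun U => ∑ i, a i * u i U) with hNudef
  set Nv := tubeNormSq (softWeight (χ β)) (fun U => ∑ i, a i * v i U) with hNvdef
  have ham := offdiag_pot_split hσμ0 hθ hb hNu hNv hPa
  set Quu' : ℝ := tubeForm β (fun U => ∑ i, a i * u i U) + 4 / θ * (σ * μ0) * P a with hQuu'
  set Qvv' : ℝ := tubeForm β (fun U => ∑ i, a i * v i U) + θ / 4 * (σ * μ0) * Nv with hQvv'
  have hQ' : tubeForm β (fun U => ∑ i, a i * f i U) ≤ Quu' + 2 * (b * (σ * μ0)) * Real.sqrt Nu * Real.sqrt Nv + Qvv' := by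
    rw [hQuu', hQvv']; linarith [hQ, ham]
  have hvv' : Qvv' ≤ (1 - θ') * (σ * μ0) * Nv := by
    rw [hQvv', hθ']
    have e : (1 - 3 * θ / 4) * (σ * μ0) * Nv = (1 - θ) * (σ * μ0) * Nv + θ / 4 * (σ * μ0) * Nv := by ring
    rw [e]; linarith [hvv]
  -- `ε := (4C/3)λ`
  have hb2' : b ^ 2 ≤ 4 * C / 3 * lam * θ' * lam / 16 := by
    have e : 4 * C / 3 * lam * θ' * lam / 16 = C * lam ^ 2 * θ / 16 := by rw [hθ']; ring
    rw [e]; exact hb2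
  have eC : 4 * C / 3 * lam / 4 * lam = C * lam ^ 2 / 3 := by ring
  have hC3 : C * lam ^ 2 / 4 ≤ C * lam ^ 2 / 3 := by
    have := mul_nonneg hC0 (sq_nonneg lam); linarith
  have hfloor' : Real.exp (-(4 * C / 3 * lam / 4 * lam)) * (σ * μ0) ≤ levelValue su2Rep L β 0 := by
    refine le_trans (mul_le_mul_of_nonneg_right (Real.exp_le_exp.2 ?_) hσμ0) hfloor
    rw [eC]; linarith
  have hμk0 : 0 ≤ μk := by linarith
  have huu' : Quu' ≤ Real.exp (4 * C / 3 * lam / 4 * lam) * (σ * μk) * Nu := by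
    refine huu.trans (mul_le_mul_of_nonneg_right (mul_le_mul_of_nonneg_right (Real.exp_le_exp.2 ?_) (mul_nonneg hσ.le hμk0)) hNu)
    rw [eC]; exact hC3
  have key := feshbach_endgame (ε := 4 * C / 3 * lam) (by positivity) hlam0.le hσ.le hθ'0 hμ0.le hμk2 hμkθ hNu hNv hN hb2' hfloor' hvv' hQ' huu'
  have e : 4 * C / 3 * lam * lam = 4 * C / 3 * lam ^ 2 := by ring
  rw [e] at key
  exact key

/-! ## §3 ★★★ The chain: one-orbit inner rate, eight copies, K1 -/

/-- ★★★ **INNER NO-INTRUDER WITH RATE (physical families near the eight torons) ⇐ the v3 package**, for an admissible weight at a positive scale `δ` eventually `≤ 1/(2L)`: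
endgame + `oneOrbitRate_of_softTubeRateOn` + FCL's `innerRate_of_oneOrbitRate`. [cite: Luscher1983, §3] [cite: GustafsonSigal2003, §11–§12] -/
theorem innerRateAt_of_ratePackagePot (k : ℕ) {δ : ℝ → ℝ} {χ : ℝ → GaugeConfig 3 L SU2 → ℝ} (hδ : ∀ β, 0 < δ β)
    (hδL : ∃ β1 : ℝ, ∀ β : ℝ, β1 ≤ β → δ β ≤ 1 / (2 * L)) (hT : SoftTubeAdmissible L δ χ)
    (hP : SoftTubeBORatePackagePotOn L χ (fun β => {U | orbitDist U < δ β})) :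
    ∃ C βI : ℝ, ∀ β : ℝ, βI ≤ β →
      ∀ F : Fin (k + 1) → (GaugeConfig 3 L SU2 → ℝ), (∀ i, IsPhys (F i)) →
        (∀ i U, F i U ≠ 0 → ∃ z : Fin 3 → Bool, orbitDist (TT.twist3 z U) < δ β) →
        (∀ a : Fin (k + 1) → ℝ, a ≠ 0 → 0 < l2 (fun U => ∑ i, a i * F i U) (fun U => ∑ i, a i * F i U)) →
          ∃ a : Fin (k + 1) → ℝ, a ≠ 0 ∧
            qform su2Rep β (fun U => ∑ i, a i * F i U) (fun U => ∑ i, a i * F i U) * levelValue su2Rep 1 ((L : ℝ) ^ 3 * β) 0 ≤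
              Real.exp (C * bareLambda ((L : ℝ) ^ 3 * β) ^ 2) * levelValue su2Rep 1 ((L : ℝ) ^ 3 * β) k *
                levelValue su2Rep L β 0 * l2 (fun U => ∑ i, a i * F i U) (fun U => ∑ i, a i * F i U) :=
  innerRate_of_oneOrbitRate k hδ hδL (oneOrbitRate_of_softTubeRateOn hT (softTubeNoIntruderRateOn_of_ratePackagePot hP) k)

/-- ★★★★ **K1 `NearFlatRatioLaw` ⇐ the v3 package for the record CORE weight `recordChi L (1/6) 43 M` (`M ≥ 2`), test support `{orbitDist < β^{−1/6}}`, on every `L ≥ 2`, + lane A's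
action-free SHELL** on `(β^{-1/6}, β^{-1/40})`: `innerRateAt_of_ratePackagePot` at `k = 1` + `nearFlatRatioLaw_of_coreRate_shell_pow` (rate two-zone glue, IMS cut at `β^{-1/6}` costs
`O(λ_b²)λ₀`). [cite: Luscher1983, §3] -/
theorem nearFlatRatioLaw_of_ratePackagePot_shell (M : ℝ) (hM : 2 ≤ M)
    (hP : ∀ (L : ℕ) [NeZero L], 2 ≤ L → SoftTubeBORatePackagePotOn L (recordChi L (1 / 6) 43 M) (fun β => {U | orbitDist U < powScale (1 / 6) β}))
    (hshell : ∀ (L : ℕ) [NeZero L], 2 ≤ L → InnerShellGainAt L (powScale (1 / 6)) (powScale (1 / 40))) :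
    Summit.QuantumFields.YangMills.Theses.FlatTubeReduction.NearFlatRatioLaw :=
  nearFlatRatioLaw_of_coreRate_shell_pow
    (fun L _ hL => innerRateAt_of_ratePackagePot (L := L) 1 (fun β => powScale_pos (1 / 6) β) powScale_sixth_eventually_le
      (softTubeAdmissible_recordChi' (1 / 6) 43 M (by norm_num) hM) (hP L hL))
    hshell

end Summit.QuantumFields.YangMills.Theorems.FemtoTransferGap.RateTube

end
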